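/-
Copyright (c) 2026 the pub-hodgecm-mathlib formalisation cell (harness21).  Prover seat hodgecm-mathlib-K2Liu-p12 (g4): Track B «K2-LIT»,
#184♮ = hLiu418 = stmt-HodgeConjecture-24832; Road Φ of socket #41, Φ9 consumer sheet «G3-inst» (LEAD F0P6-plan (g14) BATCH #28 (1) 2026-09-04T14:09:56Z);
census `K2/K2Liu-p12/g4/CENSUS-G3inst-SkewCarrierBridge.K2Liu-p12-g4.md` (I-2).  File B2.
-/
import Summits.HodgeConjecture.HodgeConjecture.Theorems.K2LiuSkewLatticeShells          -- ★ F3b: balls of `S` (+ ★ `K2LiuUnipDeltaConjugationModulus`: `exists_homeomorph_skew`, topology of `M_n(E ⊗ F_v)`)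
import Literature.NumberTheory.Automorphic.ValuedFieldValuativeRelBridge                -- ★ `v_le_one_iff_valuation_le_one`
import HarnessLib

/-!
# Crux `HLiu418`, Road Φ of socket #41, «G3-inst» (I-2) — HAAR TRANSPORT `N_Δ(F_v) ≃ₜ Skew`: the additive Haar measure `n^* ν` on the Skew carrier,
# `∫_{N_Δ(F_v)} g dν = ∫_S g(n(t)) d(n^*ν)(t)`, and the volume letter `(n^*ν)(B(0)) = ν(N_Δ(F_v) ∩ K_v)`

Cell `hodgecm-mathlib`, crux item hLiu418 = `stmt-HodgeConjecture-24832`, route of record `HCCMUnconditional`; squad K2 ∕ K2Liu, road `K2_Liu`,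
socket #41 `sig_K2LiuSiegelEisensteinContinuation`, Road Φ; consumer = the Φ9 tie through ★ G1-close `K2LiuWhittakerDeltaEulerProduct` (local factors
`∫_{N_Δ(L⁺_v)} conj ψ_S(ι_v y)·Λ_{s,v}(w_Δ y) dν_v(y)`) and the Skew-carrier local files ★ Φ4 `K2LiuGoodPlaceWhittakerBound`, ★ R1
`K2LiuGoodPlaceWhittakerNonUnimodular`, ★ E7 `K2LiuGoodPlaceWhittakerUnimodularValueCM`, ★ Φ5-tie `K2LiuBadPlaceWhittakerEntire`
(`∫_{B(−k)} φ_s(w_Δ·n(t))·ψ(−τ tr(βt)) dμ(t)`, `μ` an additive Haar measure on `S`).  THEOREMS ONLY (no `def`, no `instance`, no `notation`, no named-fact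
hypothesis, no `sorry`); lane `--supports stmt-HodgeConjecture-24832` (count-neutral helper; closes no socket by itself).

THE MATHEMATICS [Weil1965, §37], [HarrisKudlaSweet1996, §1 (1.11)–(1.12)], [Casselman1980, §3].  `S = Skew_{T₀}(E ⊗ F_v)` (any additive subgroup with the skew
carrier, letter `hS` of ★ F3b) and ANY subgroup `N′ ≤ H(F_v)` with the carrier of ★ D10 `unipDeltaLocal` (letter `hN′` — so that both ★ D10's `N_Δ(F_v)` and the
global-comap `unipDeltaLoc v` of ★ `K2LiuSiegelUnipotentLocalDefs`, identified in file B1, are served) are homeomorphic groups along `u ↦ B(matA u)`, `t ↦ n(t)`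
(★ `K2LiuUnipDeltaConjugationModulus.exists_homeomorph_skew`, any rank):
* §1 generic transport: a homeomorphism `ψ : N ≃ₜ S` turning `·` into `+` pushes a Haar measure of `N` to an ADDITIVE HAAR MEASURE of `S` (`isAddHaarMeasure_map_of_mul`),
  REGULAR on a second countable locally compact `S` (`regular_map_of_mul`); `∫ g dν = ∫ t, g(ψ⁻¹ t) d(ψ_*ν)` (`integral_map_symm_eq`).
* §2 the Skew instance: `exists_homeomorph_skew_of_carrier` (for `N′` with `hN′`), `homeomorph_map_mul` (`·` → `+` from the letter `hψ : (ψ u).1 = B(matA u)`),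
  `coe_symm_apply_eq_nElem` (`ψ⁻¹ t = n(t)`), **`isAddHaarMeasure_map_skew`**, **`regular_map_skew`**, **`integral_eq_integral_nElem`**:
  `∫_{N′} g(u) dν(u) = ∫_S g(n(t)) d(ψ_*ν)(t)` — so G1-close's local factor IS a Skew-carrier integral for the Haar measure `μ := ψ_*ν_v`.
* §3 THE VOLUME LETTER at `|2|_w = 1`: **`map_apply_ball_zero_eq`**: `(ψ_*ν)(B(0)) = ν{u ∈ N′ | u ∈ K_v}` (★ `mem_localInt_iff_isIntegralAt_blkB`: `n(t) ∈ K_v ⟺ t` integral),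
  so Φ3c's normalisation `ν_v(K_{H,v} ∩ N_Δ(L⁺_v)) = 1` (letter `hνK` of ★ G1-close) reads `μ(B(0)) = 1` = the `m v = 1` of ★ (b) `hasProd_whittaker_of_vol_eq_one`.
HONEST LABEL.  Count-neutral helper; it retires nothing by itself: `HC_CM` is proved only modulo the 7 printed citations (2 remaining named inputs:
hLiu418 = `stmt-HodgeConjecture-24832`, h413 = `stmt-HodgeConjecture-24833`) until rung 0 closes.

## References
* [Weil1965] A. Weil, *L'intégration dans les groupes topologiques et ses applications* (2nd ed. 1965), §37 (transport of Haar measure along isomorphisms).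
* [HarrisKudlaSweet1996] M. Harris, S. Kudla, W. J. Sweet, J. AMS 9 (1996): §1 (1.11)–(1.12) (`N_Δ ≅ Herm_n`, the coordinate `n(X)`).
* [Casselman1980] W. Casselman, Compositio Math. 40 (1980): §3 (`N ∩ K`, normalisation of local measures).
* [Tan1999] V. Tan, Canad. J. Math. 51 (1999): §2 (local measures normalised by `vol(N(𝒪_v)) = 1` off a finite set).
-/

set_option autoImplicit false
-- the mandated namespace repeats the single-problem summit's segment (`HodgeConjecture.HodgeConjecture`)
set_option linter.dupNamespace false

noncomputable section

open scoped NNReal ENNReal Matrix Topology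
open NumberField IsDedekindDomain Matrix MeasureTheory MeasureTheory.Measure Set Filter
open Literature.NumberTheory.Automorphic Literature.NumberTheory.Automorphic.UnitaryGroup
open Literature.NumberTheory.GelbartRogawski1991.AdaptedBlocks
open Literature.NumberTheory.GelbartRogawski1991.UnitaryDualPair.LocalSplitting
open Literature.NumberTheory.K2Lit.LocalSiegelDoubled
open Summit.HodgeConjecture.HodgeConjecture.Cruxes.HLiu418.K2LiuUnipDeltaLocalCoordinates
open Summit.HodgeConjecture.HodgeConjecture.Cruxes.HLiu418.K2LiuUnipDeltaConjugationModulus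
open Summit.HodgeConjecture.HodgeConjecture.Cruxes.HLiu418.K2LiuUnipDeltaRankOneHaar (continuous_blkB_matA)
open Summit.HodgeConjecture.HodgeConjecture.Cruxes.HLiu418.K2LiuSkewConjugationHaarChar
open Summit.HodgeConjecture.HodgeConjecture.Cruxes.HLiu418.K2LiuLocalRingValuationBalls
open Summit.HodgeConjecture.HodgeConjecture.Cruxes.HLiu418.K2LiuSkewLatticeShells

namespace Summit.HodgeConjecture.HodgeConjecture.Cruxes.HLiu418.K2LiuUnipDeltaLocalHaarTransport

/-! ## §1 Generic transport of a Haar measure along a multiplicative-to-additive homeomorphism -/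

section Generic

variable {N : Type*} [Group N] [TopologicalSpace N] [IsTopologicalGroup N] [MeasurableSpace N] [BorelSpace N]
  {S : Type*} [AddCommGroup S] [TopologicalSpace S] [IsTopologicalAddGroup S] [T2Space S] [MeasurableSpace S] [BorelSpace S]

/-- **the push-forward of a Haar measure along a homeomorphism `ψ : N ≃ₜ S` with `ψ(uu′) = ψ u + ψ u′` is an additive Haar measure** (finite on compacts and
positive on opens by the homeomorphism; left-invariant because `t + · = ψ ∘ (ψ⁻¹t · ) ∘ ψ⁻¹`).  [cite: Weil1965, §37] -/
theorem isAddHaarMeasure_map_of_mul (ψ : N ≃ₜ S) (hψ : ∀ u u', ψ (u * u') = ψ u + ψ u') (νN : Measure N) [νN.IsHaarMeasure] :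
    (Measure.map ψ νN).IsAddHaarMeasure := by
  have hfin : ∀ K : Set S, IsCompact K → Measure.map ψ νN K < ⊤ := fun K hK => by
    rw [Measure.map_apply ψ.measurable hK.measurableSet]
    exact (ψ.isCompact_preimage.2 hK).measure_lt_top
  haveI : IsFiniteMeasureOnCompacts (Measure.map ψ νN) := ⟨fun K hK => hfin K hK⟩
  haveI : (Measure.map ψ νN).IsOpenPosMeasure := ⟨fun U hU hne => by
    rw [Measure.map_apply ψ.measurable hU.measurableSet]
    exact (hU.preimage ψ.continuous).measure_ne_zero νN (hne.preimage ψ.surjective)⟩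
  haveI : (Measure.map ψ νN).IsAddLeftInvariant := ⟨fun t => by
    have hadd : Measurable fun x : S => t + x := (continuous_const.add continuous_id).measurable
    have hmul : Measurable fun u : N => ψ.symm t * u := (continuous_const.mul continuous_id).measurable
    rw [Measure.map_map hadd ψ.measurable]
    have hcomp : ((fun x : S => t + x) ∘ ψ) = (ψ ∘ fun u => ψ.symm t * u) := by
      funext u
      simp only [Function.comp_apply]
      rw [hψ, ψ.apply_symm_apply]
    rw [hcomp, ← Measure.map_map ψ.measurable hmul, map_mul_left_eq_self νN (ψ.symm t)]⟩
  exact { toIsFiniteMeasureOnCompacts := inferInstance, toIsAddLeftInvariant := inferInstance, toIsOpenPosMeasure := inferInstance }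

/-- the push-forward is REGULAR when `S` is second countable and locally compact (Mathlib `regular_of_isAddLeftInvariant`). [cite: Weil1965, §37] -/
theorem regular_map_of_mul [LocallyCompactSpace S] [SecondCountableTopology S] (ψ : N ≃ₜ S) (hψ : ∀ u u', ψ (u * u') = ψ u + ψ u')
    (νN : Measure N) [νN.IsHaarMeasure] : (Measure.map ψ νN).Regular := by
  haveI := isAddHaarMeasure_map_of_mul ψ hψ νN
  obtain ⟨K⟩ := (inferInstance : Nonempty (TopologicalSpace.PositiveCompacts S))
  exact regular_of_isAddLeftInvariant K.isCompact K.interior_nonempty K.isCompact.measure_lt_top.ne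

omit [Group N] [IsTopologicalGroup N] [AddCommGroup S] [IsTopologicalAddGroup S] [T2Space S] in
/-- **change of variables along the homeomorphism**: `∫_S g(ψ⁻¹ t) d(ψ_*ν)(t) = ∫_N g(u) dν(u)` (Mathlib `integral_map_equiv`). [cite: Weil1965, §37] -/
theorem integral_map_symm_eq {G : Type*} [NormedAddCommGroup G] [NormedSpace ℝ G] (ψ : N ≃ₜ S) (νN : Measure N) (g : N → G) :
    ∫ t, g (ψ.symm t) ∂(Measure.map ψ νN) = ∫ u, g u ∂νN := by
  have h := integral_map_equiv ψ.toMeasurableEquiv (μ := νN) (fun t => g (ψ.symm t))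
  rw [Homeomorph.toMeasurableEquiv_coe] at h
  rw [h]
  simp only [Homeomorph.symm_apply_apply]

end Generic

/-! ## §2 The Skew instance: `N′ ≃ₜ S` along `u ↦ B(matA u)`, `t ↦ n(t)` -/

section Skew

variable (F : Type) [Field F] [NumberField F] (E : Type) [Field E] [NumberField E] [Algebra F E]
  [Algebra.IsQuadraticExtension F E] (c : E ≃ₐ[F] E)
  (v : HeightOneSpectrum (𝓞 F)) (n : ℕ) {T₀ : Matrix (Fin n) (Fin n) F}
  {JD : Matrix (Fin (n + n)) (Fin (n + n)) E} (hJD : JD = (gramD F n T₀).map (algebraMap F E))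
  {π : v.adicCompletion F} (hπ : Valued.v π = WithZero.exp (-1 : ℤ))
  (N' : Subgroup (UnitaryGroup.localPi E c (n + n) JD v)) (hN' : ∀ u, u ∈ N' ↔ u ∈ unipDeltaLocal F E c v n (JD := JD))
  (S : AddSubgroup (Matrix (Fin n) (Fin n) (LocalRing E v)))
  (hS : ∀ t, t ∈ S ↔ (t.map (conjLocal E c v))ᵀ * gramS F E v n T₀ + gramS F E v n T₀ * t = 0)

omit [Algebra.IsQuadraticExtension F E] in
include hJD hN' hS in
/-- **`N′ ≃ₜ Skew`, `u ↦ B(matA u)`** (inverse `t ↦ n(t)`), for ANY subgroup `N′` with the carrier of ★ D10 `N_Δ(F_v)` (letter `hN′`; e.g. the global-comap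
`unipDeltaLoc v` of ★ `K2LiuSiegelUnipotentLocalDefs` after file B1) and any additive subgroup `S` with the skew carrier (`hS`) — the twin of ★
`exists_homeomorph_skew` off the literal subgroup `unipDeltaLocal`. [cite: HarrisKudlaSweet1996, §1 (1.11)–(1.12)] [cite: Weil1965, §37] -/
theorem exists_homeomorph_skew_of_carrier :
    ∃ ψ : N' ≃ₜ S, (∀ u, (ψ u).1 = blkB (matA F E c v n (u : UnitaryGroup.localPi E c (n + n) JD v))) ∧ (∀ u u', ψ (u * u') = ψ u + ψ u') := by
  refine ⟨⟨⟨fun u => ⟨blkB (matA F E c v n (u : UnitaryGroup.localPi E c (n + n) JD v)), (hS _).2 (skew_blkB_of_mem_unipDeltaLocal F E c v n hJD ((hN' _).1 u.2))⟩,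
    fun t => ⟨nElem F E c v n hJD t.1 ((hS t.1).1 t.2), (hN' _).2 (nElem_mem_unipDeltaLocal F E c v n hJD t.1 ((hS t.1).1 t.2))⟩,
    fun u => Subtype.ext (eq_nElem_of_mem_unipDeltaLocal F E c v n hJD ((hN' _).1 u.2)).symm, fun t => Subtype.ext (blkB_matA_nElem F E c v n hJD ((hS t.1).1 t.2))⟩,
    ((continuous_blkB_matA F E c v n).comp continuous_subtype_val).subtype_mk _, ?_⟩, fun u => rfl, fun u u' => Subtype.ext ?_⟩
  · -- continuity of `t ↦ n(t)` into the subtype `N′`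
    exact (continuous_subtype_val.comp (continuous_nElem_skew F E c v n hJD S hS)).subtype_mk _
  · show blkB (matA F E c v n ((u : UnitaryGroup.localPi E c (n + n) JD v) * (u' : UnitaryGroup.localPi E c (n + n) JD v))) =
      blkB (matA F E c v n (u : UnitaryGroup.localPi E c (n + n) JD v)) + blkB (matA F E c v n (u' : UnitaryGroup.localPi E c (n + n) JD v))
    conv_lhs => rw [eq_nElem_of_mem_unipDeltaLocal F E c v n hJD ((hN' _).1 u.2), eq_nElem_of_mem_unipDeltaLocal F E c v n hJD ((hN' _).1 u'.2),
      ← nElem_add F E c v n hJD, blkB_matA_nElem]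

variable {N' S}

omit [Algebra.IsQuadraticExtension F E] in
include hJD hN' hS in
/-- from the coordinate letter `hψ : (ψ u).1 = B(matA u)`: **`ψ` turns products into sums** (`B(matA(uu′)) = B(matA u) + B(matA u′)` on `N_Δ(F_v)`,
★ `nElem_add` + ★ `blkB_matA_nElem`). [cite: HarrisKudlaSweet1996, §1 (1.11)] -/
theorem homeomorph_map_mul (ψ : N' ≃ₜ S) (hψ : ∀ u, (ψ u).1 = blkB (matA F E c v n (u : UnitaryGroup.localPi E c (n + n) JD v))) (u u' : N') :
    ψ (u * u') = ψ u + ψ u' := by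
  refine Subtype.ext ?_
  rw [hψ, AddSubgroup.coe_add, hψ, hψ]
  show blkB (matA F E c v n ((u : UnitaryGroup.localPi E c (n + n) JD v) * (u' : UnitaryGroup.localPi E c (n + n) JD v))) = _
  have hu := (hN' _).1 u.2
  have hu' := (hN' _).1 u'.2
  have hsum : ((blkB (matA F E c v n (u : UnitaryGroup.localPi E c (n + n) JD v)) + blkB (matA F E c v n (u' : UnitaryGroup.localPi E c (n + n) JD v))).map
      (conjLocal E c v))ᵀ * gramS F E v n T₀ + gramS F E v n T₀ * (blkB (matA F E c v n (u : UnitaryGroup.localPi E c (n + n) JD v)) +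
        blkB (matA F E c v n (u' : UnitaryGroup.localPi E c (n + n) JD v))) = 0 :=
    (hS _).1 (S.add_mem ((hS _).2 (skew_blkB_of_mem_unipDeltaLocal F E c v n hJD hu)) ((hS _).2 (skew_blkB_of_mem_unipDeltaLocal F E c v n hJD hu')))
  conv_lhs => rw [eq_nElem_of_mem_unipDeltaLocal F E c v n hJD hu, eq_nElem_of_mem_unipDeltaLocal F E c v n hJD hu', ← nElem_add F E c v n hJD,
    blkB_matA_nElem]

omit [Algebra.IsQuadraticExtension F E] in
include hJD hS in
/-- **`ψ⁻¹ t = n(t)`**: the inverse coordinate of a homeomorphism with the letter `hψ` is ★ `nElem` (`B(matA(n t)) = t`, injectivity of `ψ`).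
[cite: HarrisKudlaSweet1996, §1 (1.11)–(1.12)] -/
theorem coe_symm_apply_eq_nElem (ψ : N' ≃ₜ S) (hψ : ∀ u, (ψ u).1 = blkB (matA F E c v n (u : UnitaryGroup.localPi E c (n + n) JD v)))
    (hn : ∀ t : S, nElem F E c v n hJD t.1 ((hS t.1).1 t.2) ∈ N') (t : S) :
    ((ψ.symm t : N') : UnitaryGroup.localPi E c (n + n) JD v) = nElem F E c v n hJD t.1 ((hS t.1).1 t.2) := by
  have h : ψ ⟨nElem F E c v n hJD t.1 ((hS t.1).1 t.2), hn t⟩ = t :=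
    Subtype.ext (by rw [hψ]; exact blkB_matA_nElem F E c v n hJD ((hS t.1).1 t.2))
  have h' : ψ.symm t = ⟨nElem F E c v n hJD t.1 ((hS t.1).1 t.2), hn t⟩ := ψ.injective (by rw [ψ.apply_symm_apply, h])
  rw [h']

omit [Algebra.IsQuadraticExtension F E] in
include hJD hN' hS in
/-- the membership `n(t) ∈ N′` for every skew `t` (★ `nElem_mem_unipDeltaLocal` through `hN′`). [cite: HarrisKudlaSweet1996, §1 (1.11)] -/
theorem nElem_mem (t : S) : nElem F E c v n hJD t.1 ((hS t.1).1 t.2) ∈ N' :=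
  (hN' _).2 (nElem_mem_unipDeltaLocal F E c v n hJD t.1 ((hS t.1).1 t.2))

variable [MeasurableSpace N'] [BorelSpace N'] [MeasurableSpace S] [BorelSpace S]

omit [Algebra.IsQuadraticExtension F E] in
include hJD hN' hS in
/-- **THE TRANSPORTED MEASURE `ψ_*ν` IS AN ADDITIVE HAAR MEASURE ON `Skew`** for every Haar measure `ν` of `N′` — the `μ` of the Skew-carrier local files
★ Φ4∕Φ5∕E7∕R1. [cite: Weil1965, §37] [cite: Casselman1980, §3] -/
theorem isAddHaarMeasure_map_skew (ψ : N' ≃ₜ S) (hψ : ∀ u, (ψ u).1 = blkB (matA F E c v n (u : UnitaryGroup.localPi E c (n + n) JD v)))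
    (νN : Measure N') [νN.IsHaarMeasure] : (Measure.map ψ νN).IsAddHaarMeasure :=
  isAddHaarMeasure_map_of_mul ψ (homeomorph_map_mul F E c v n hJD hN' hS ψ hψ) νN

omit [Algebra.IsQuadraticExtension F E] in
include c hJD hN' hS in
/-- **… and REGULAR** (`Skew` is a closed subgroup of the second countable locally compact `M_n(E ⊗ F_v)`: ★ `isClosed_skew`, ★ `secondCountableTopology_matrix_localRing`,
★ `locallyCompactSpace_matrix_localRing`) — the `[μ.Regular]` of ★ Φ4 (ii) `goodPlace_whittaker_setIntegral_ball_eq`. [cite: Weil1965, §37] -/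
theorem regular_map_skew (ψ : N' ≃ₜ S) (hψ : ∀ u, (ψ u).1 = blkB (matA F E c v n (u : UnitaryGroup.localPi E c (n + n) JD v)))
    (νN : Measure N') [νN.IsHaarMeasure] : (Measure.map ψ νN).Regular := by
  haveI : SecondCountableTopology (Matrix (Fin n) (Fin n) (LocalRing E v)) := secondCountableTopology_matrix_localRing F E v n
  haveI : LocallyCompactSpace (Matrix (Fin n) (Fin n) (LocalRing E v)) := locallyCompactSpace_matrix_localRing F E v n
  haveI : LocallyCompactSpace S := (isClosed_skew F E c v n S hS).isClosedEmbedding_subtypeVal.locallyCompactSpace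
  haveI : SecondCountableTopology S := TopologicalSpace.Subtype.secondCountableTopology _
  exact regular_map_of_mul ψ (homeomorph_map_mul F E c v n hJD hN' hS ψ hψ) νN

omit [Algebra.IsQuadraticExtension F E] [MeasurableSpace N'] [BorelSpace N'] [MeasurableSpace S] [BorelSpace S] in
include c hS in
/-- `Skew` is locally compact (the `[LocallyCompactSpace S]` of ★ Φ4 (ii)). [cite: Weil1965, §37] -/
theorem locallyCompactSpace_skew : LocallyCompactSpace S := by
  haveI : LocallyCompactSpace (Matrix (Fin n) (Fin n) (LocalRing E v)) := locallyCompactSpace_matrix_localRing F E v n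
  exact (isClosed_skew F E c v n S hS).isClosedEmbedding_subtypeVal.locallyCompactSpace

omit [Algebra.IsQuadraticExtension F E] in
include hJD hN' hS in
/-- **`∫_{N′} g(u) dν(u) = ∫_S g(n(t)) d(ψ_*ν)(t)`** for every `g : H(F_v) → G` — G1-close's local factor IS a Skew-carrier integral for `μ := ψ_*ν_v`
(change of variables along `ψ`, `ψ⁻¹ = n`). [cite: Weil1965, §37] [cite: HarrisKudlaSweet1996, §1 (1.12)] -/
theorem integral_eq_integral_nElem {G : Type*} [NormedAddCommGroup G] [NormedSpace ℝ G] (ψ : N' ≃ₜ S)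
    (hψ : ∀ u, (ψ u).1 = blkB (matA F E c v n (u : UnitaryGroup.localPi E c (n + n) JD v))) (νN : Measure N')
    (g : UnitaryGroup.localPi E c (n + n) JD v → G) :
    ∫ u, g (u : UnitaryGroup.localPi E c (n + n) JD v) ∂νN = ∫ t, g (nElem F E c v n hJD t.1 ((hS t.1).1 t.2)) ∂(Measure.map ψ νN) := by
  rw [← integral_map_symm_eq ψ νN (fun u : N' => g (u : UnitaryGroup.localPi E c (n + n) JD v))]
  refine integral_congr_ae (Filter.Eventually.of_forall fun t => ?_)
  simp only
  rw [coe_symm_apply_eq_nElem F E c v n hJD hS ψ hψ (nElem_mem F E c v n hJD hN' hS)]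

/-! ## §3 The volume letter `(ψ_*ν)(B(0)) = ν(N′ ∩ K_v)` at `|2|_w = 1` -/

omit [Algebra.IsQuadraticExtension F E] in
include hJD hπ hN' in
/-- **`(ψ_*ν)(B(0)) = ν{u ∈ N′ | u ∈ K_v}`** at a place with `|2|_w = 1` for all `w ∣ v`: `n(t) ∈ K_v = H(𝒪_v)` iff `t` is integral at every `w` (★
`mem_localInt_iff_isIntegralAt_blkB`), and «integral at `w`» is the ball exponent `0` (★ `v_le_one_iff_valuation_le_one`).  With Φ3c's normalisation
`ν_v(K_{H,v} ∩ N_Δ(L⁺_v)) = 1` this is `μ(B(0)) = 1` — the `m v = 1` of ★ (b) `hasProd_whittaker_of_vol_eq_one`. [cite: Casselman1980, §3] [cite: Tan1999, §2] -/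
theorem map_apply_ball_zero_eq (h2 : ∀ w : PlacesOver E v, ValuativeRel.valuation (w.1.adicCompletion E) (2 : w.1.adicCompletion E) = 1)
    (ψ : N' ≃ₜ S) (hψ : ∀ u, (ψ u).1 = blkB (matA F E c v n (u : UnitaryGroup.localPi E c (n + n) JD v))) (νN : Measure N') :
    Measure.map ψ νN {t : S | ∀ i j (w : PlacesOver E v), Valued.v (t.1 i j w) ≤ Valued.v (toPlace v w π) ^ (0 : ℤ)} =
      νN {u : N' | (u : UnitaryGroup.localPi E c (n + n) JD v) ∈ UnitaryGroup.localInt E c (n + n) JD v} := by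
  rw [Measure.map_apply ψ.measurable (K2LiuSkewLatticeShells.measurableSet_ball F E v hπ n S 0)]
  congr 1
  ext u
  simp only [Set.mem_preimage, Set.mem_setOf_eq, zpow_zero]
  rw [mem_localInt_iff_isIntegralAt_blkB F E c v n hJD h2 ((hN' _).1 u.2)]
  constructor
  · intro h w i j
    have hij : Valued.v (blkB (matA F E c v n (u : UnitaryGroup.localPi E c (n + n) JD v)) i j w) ≤ 1 := by rw [← hψ]; exact h i j w
    exact (v_le_one_iff_valuation_le_one _).1 hij
  · intro h i j w
    have hij : ValuativeRel.valuation (w.1.adicCompletion E) (blkB (matA F E c v n (u : UnitaryGroup.localPi E c (n + n) JD v)) i j w) ≤ 1 := h w i j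
    rw [hψ]
    exact (v_le_one_iff_valuation_le_one _).2 hij

omit [Algebra.IsQuadraticExtension F E] in
include hJD hπ hN' in
/-- the same in `ℝ` (`μ.real`, the currency of ★ Φ4 (iii) ∕ ★ R1 ∕ ★ E7). [cite: Casselman1980, §3] -/
theorem measureReal_map_ball_zero_eq (h2 : ∀ w : PlacesOver E v, ValuativeRel.valuation (w.1.adicCompletion E) (2 : w.1.adicCompletion E) = 1)
    (ψ : N' ≃ₜ S) (hψ : ∀ u, (ψ u).1 = blkB (matA F E c v n (u : UnitaryGroup.localPi E c (n + n) JD v))) (νN : Measure N') :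
    (Measure.map ψ νN).real {t : S | ∀ i j (w : PlacesOver E v), Valued.v (t.1 i j w) ≤ Valued.v (toPlace v w π) ^ (0 : ℤ)} =
      νN.real {u : N' | (u : UnitaryGroup.localPi E c (n + n) JD v) ∈ UnitaryGroup.localInt E c (n + n) JD v} := by
  rw [measureReal_def, measureReal_def, map_apply_ball_zero_eq F E c v n hJD hπ hN' h2 ψ hψ νN]

end Skew

end Summit.HodgeConjecture.HodgeConjecture.Cruxes.HLiu418.K2LiuUnipDeltaLocalHaarTransport

end
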